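import Summits.AtomisticToContinuum.HydrodynamicLimit.Theses.BoxDissipativeWeakStrong
import Summits.AtomisticToContinuum.HydrodynamicLimit.Theorems.BoxDissipativeWeakStrongDefs
import Summits.AtomisticToContinuum.HydrodynamicLimit.Theorems.BoxDissipativeWeakStrongEntropyAdmissibilityStubEntropyModulus
import Summits.AtomisticToContinuum.HydrodynamicLimit.Theorems.BoxDissipativeWeakStrongEntropyAdmissibilityStubInitialEntropyLLN
import Summits.AtomisticToContinuum.HydrodynamicLimit.Theorems.BoxDissipativeWeakStrongEntropyAdmissibilityStubDynPartIntegrable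
import Summits.AtomisticToContinuum.HydrodynamicLimit.Theorems.BoxDissipativeWeakStrongEntropyAdmissibilityMeanEntropyDeficitNecessary

/-!
# Crux `EntropyAdmissibility` (stmt-AtomisticToContinuum-9903), line `registered` — stub `stub_dynamicCoreSandwich`

The exact ATOMIC form of the crux and the sandwich around it (tightness of the line's cut).

Write the crux's clamp-renormalised entropy-balance functional as `Q_N = A_N + B_N` (dynamic part `A_N = dynPart`,
initial part `B_N = initPart`) and let `B = initLimit` be the clamped cut entropy of the Euler data. The
**dynamic core** of the crux is the statement, in the crux's own quantifier frame,

  `DynCore :  E_{P_N}[(A_N + B)⁺] → 0`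

(outer integral `∫⁻ ofReal`, exactly as in the crux). This file proves, sorry-free and over LANDED theorems only
(S0 = initial entropy LLN `E|B_N − B| → 0`: `EABirthS0b.stub_initialEntropyLLN_of_modulus EABirthS0a.stub_entropyModulus`;
S1a = `EABirthS1a.stub_dynPartIntegrable`; the one-sided squeeze `EABirthS1bNec.eventually_integral_add_const_le`):

* `EntropyAdmissibility ↔ DynCore` (`(A + B)⁺ ≤ (A + B_N)⁺ + |B_N − B|` and conversely, integrated; S0);
* `DynCore → S1b` (`E[A_N] + B = E[A_N + B] ≤ E[(A_N + B)⁺]`; S1a), where S1b = `stub_meanEntropyDeficit` is the OPEN heart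
  of the line (`∀ ε > 0`, eventually `E[A_N] + B ≤ ε`);
* `S1b → S2 → DynCore` (`(A + B)⁺ ≤ |A − E A| + (E A + B)⁺`; S1a), where S2 = `stub_entropyBalanceConcentration`
  (`A_N − E A_N → 0` in `L¹(P_N)`, itself = S2b(landed) ∘ S2a(open)).

So the crux is EQUIVALENT to its dynamic core, which sits between the annealed local entropy deficit bound S1b (necessary)
and S1b ∧ S2 (sufficient): the open content of stmt-9903 is exactly `DynCore`, and the line's two open stubs S1b, S2a are
respectively its mean and its fluctuation halves. The quantifier bookkeeping of the frame (thresholds `ηc`, `σ₀` as minima)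
is done ONCE in `InFrame.mono₃`.

References: J. Březina, E. Feireisl, J. Math. Soc. Japan 70 (2018), Def. 2.9, §3.2; H. Spohn (1991), Part I Ch. 3.
-/

noncomputable section

open MeasureTheory Filter Set
open scoped ENNReal Topology

namespace Summit.AtomisticToContinuum.HydrodynamicLimit.Theorems.EABirthCore

open Literature.MathematicalPhysics.KineticTheory
open Literature.Analysis.FluidPDE.CompressibleEuler (clamp)
open Summit.AtomisticToContinuum.HydrodynamicLimit.Theses
open Summit.AtomisticToContinuum.HydrodynamicLimit.Theorems.BDWS
open Literature.Analysis.FluidPDE (Config HardSphereFlow)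
open Literature.Analysis.FunctionSpaces

/-! ## Abstract one-sided lemmas on probability spaces -/

/-- **Transfer of `L¹`-smallness of positive parts along a pointwise bound.** If `X_N ≤ Y_N + D_N` pointwise with
`D_N ≥ 0` a.e.-measurable, and `E[(Y_N)⁺] → 0`, `E[D_N] → 0` (outer integrals `∫⁻ ofReal`), then `E[(X_N)⁺] → 0`. -/
theorem tendsto_lintegral_ofReal_of_le_add {Ω : ℕ → Type*} [∀ N, MeasurableSpace (Ω N)]
    (P : ∀ N, Measure (Ω N)) (X Y D : ∀ N, Ω N → ℝ) (hle : ∀ N z, X N z ≤ Y N z + D N z)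
    (hD : ∀ N, AEMeasurable (fun z => ENNReal.ofReal (D N z)) (P N))
    (hY : Tendsto (fun N => ∫⁻ z, ENNReal.ofReal (Y N z) ∂P N) atTop (𝓝 0))
    (hDt : Tendsto (fun N => ∫⁻ z, ENNReal.ofReal (D N z) ∂P N) atTop (𝓝 0)) :
    Tendsto (fun N => ∫⁻ z, ENNReal.ofReal (X N z) ∂P N) atTop (𝓝 0) := by
  have hsum : Tendsto (fun N => (∫⁻ z, ENNReal.ofReal (Y N z) ∂P N) + ∫⁻ z, ENNReal.ofReal (D N z) ∂P N)
      atTop (𝓝 0) := by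
    simpa only [add_zero] using hY.add hDt
  refine tendsto_of_tendsto_of_tendsto_of_le_of_le' tendsto_const_nhds hsum
    (Eventually.of_forall fun N => bot_le) (Eventually.of_forall fun N => ?_)
  calc ∫⁻ z, ENNReal.ofReal (X N z) ∂P N
      ≤ ∫⁻ z, (ENNReal.ofReal (Y N z) + ENNReal.ofReal (D N z)) ∂P N :=
        lintegral_mono fun z => (ENNReal.ofReal_le_ofReal (hle N z)).trans ENNReal.ofReal_add_le
    _ = (∫⁻ z, ENNReal.ofReal (Y N z) ∂P N) + ∫⁻ z, ENNReal.ofReal (D N z) ∂P N :=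
        lintegral_add_right' _ (hD N)

/-- **Squeeze for the dynamic core.** On probability spaces `(Ω_N, P_N)`: if `A_N` is eventually integrable with
`E[A_N] + c ≤ ε` eventually for every `ε > 0`, and `A_N − E[A_N] → 0` in `L¹`, then `E[(A_N + c)⁺] → 0`
(pointwise `(A + c)⁺ ≤ |A − E A| + (E A + c)⁺`; the second term is deterministic and `P_N(Ω_N) = 1`). -/
theorem tendsto_lintegral_ofReal_add_const {Ω : ℕ → Type*} [∀ N, MeasurableSpace (Ω N)]
    (P : ∀ N, Measure (Ω N)) (hP : ∀ N, IsProbabilityMeasure (P N)) (A : ∀ N, Ω N → ℝ) (c : ℝ)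
    (h1 : ∀ ε : ℝ, 0 < ε → ∀ᶠ N in atTop, Integrable (A N) (P N) ∧ (∫ z, A N z ∂P N) + c ≤ ε)
    (h2 : Tendsto (fun N => ∫⁻ z, ENNReal.ofReal |A N z - ∫ z', A N z' ∂P N| ∂P N) atTop (𝓝 0)) :
    Tendsto (fun N => ∫⁻ z, ENNReal.ofReal (A N z + c) ∂P N) atTop (𝓝 0) := by
  -- the deterministic term tends to `0`
  have hreal : Tendsto (fun N => max ((∫ z, A N z ∂P N) + c) 0) atTop (𝓝 0) := by
    refine tendsto_order.2 ⟨fun a' ha' => Eventually.of_forall fun N => lt_of_lt_of_le ha' (le_max_right _ _),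
      fun a' ha' => ?_⟩
    filter_upwards [h1 (a' / 2) (half_pos ha')] with N hN
    exact max_lt (lt_of_le_of_lt hN.2 (half_lt_self ha')) ha'
  have hmid : Tendsto (fun N => ENNReal.ofReal (max ((∫ z, A N z ∂P N) + c) 0)) atTop (𝓝 0) := by
    simpa only [ENNReal.ofReal_zero] using ENNReal.tendsto_ofReal hreal
  have hsum : Tendsto (fun N => (∫⁻ z, ENNReal.ofReal |A N z - ∫ z', A N z' ∂P N| ∂P N) +
      ENNReal.ofReal (max ((∫ z, A N z ∂P N) + c) 0)) atTop (𝓝 0) := by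
    simpa only [add_zero] using h2.add hmid
  refine tendsto_of_tendsto_of_tendsto_of_le_of_le' tendsto_const_nhds hsum
    (Eventually.of_forall fun N => bot_le) ?_
  filter_upwards [h1 1 one_pos] with N hN
  obtain ⟨hint, -⟩ := hN
  haveI : IsProbabilityMeasure (P N) := hP N
  set m : ℝ := ∫ z', A N z' ∂P N with hm
  have hpt : ∀ z, ENNReal.ofReal (A N z + c) ≤ ENNReal.ofReal |A N z - m| + ENNReal.ofReal (max (m + c) 0) := by
    intro z
    have hle : A N z + c ≤ |A N z - m| + max (m + c) 0 := by
      have e1 := le_abs_self (A N z - m)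
      have e2 := le_max_left (m + c) 0
      linarith
    exact (ENNReal.ofReal_le_ofReal hle).trans ENNReal.ofReal_add_le
  have hmeasA : AEMeasurable (fun z => ENNReal.ofReal |A N z - m|) (P N) :=
    (continuous_abs.measurable.comp_aemeasurable
      (hint.aestronglyMeasurable.aemeasurable.sub aemeasurable_const)).ennreal_ofReal
  calc ∫⁻ z, ENNReal.ofReal (A N z + c) ∂P N
      ≤ ∫⁻ z, (ENNReal.ofReal |A N z - m| + ENNReal.ofReal (max (m + c) 0)) ∂P N := lintegral_mono hpt
    _ = (∫⁻ z, ENNReal.ofReal |A N z - m| ∂P N) + ENNReal.ofReal (max (m + c) 0) := by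
        rw [lintegral_add_left' hmeasA, lintegral_const, measure_univ, mul_one]

/-! ## The crux's quantifier frame, once -/

/-- A CONCLUSION in the crux's frame: a `Prop` depending on the frame's data `σ, η₁, a₀, θ₀, u₀, T, ρ, θ, u, Φ, ℓ, τ, a, b, φ`. -/
abbrev Conclusion : Type :=
  ∀ (σ : ℝ) (_η₁ : ℝ) (_a₀ _θ₀ : T3 → ℝ) (_u₀ : T3 → V3) (_T : ℝ) (_ρ _θ : ℝ → T3 → ℝ) (_u : ℝ → T3 → V3)
    (_Φ : FlowFamily σ) (_ℓ : ℕ → ℝ) (_τ _a _b : ℝ) (_φ : ℝ → T3 → ℝ), Prop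

/-- **The crux's quantifier frame** applied to a conclusion `C` — binders VERBATIM those of
`BoxDissipativeWeakStrong.EntropyAdmissibility` and of every `Sig.stub_*` of the line: `HsEosLowDensity →
∃ η_c > 0 ∀ η₁ < η_c ∀ continuous positive profiles ∃ σ₀ ∀ σ < σ₀ ∀ classical hs-Euler solutions on [0,T) with ρσ³ ≤ η₁/2
∀ flow families with the t = 0 LLN ∀ kinetic windows ℓ_N ∀ τ ∈ [0,T) ∀ a < b ∀ smooth φ ≥ 0 on [0,τ], C`. -/
def InFrame (C : Conclusion) : Prop :=
  BoxDissipativeWeakStrong.HsEosLowDensity →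
    ∃ ηc : ℝ, 0 < ηc ∧ ∀ η₁ : ℝ, 0 < η₁ → η₁ < ηc →
      ∀ (a₀ θ₀ : T3 → ℝ) (u₀ : T3 → V3), Continuous a₀ → Continuous θ₀ → Continuous u₀ →
        (∀ x, 0 < a₀ x) → (∀ x, 0 < θ₀ x) →
        ∃ σ₀ : ℝ, 0 < σ₀ ∧ ∀ σ : ℝ, 0 < σ → σ < σ₀ →
          ∀ (T : ℝ) (ρ θ : ℝ → T3 → ℝ) (u : ℝ → T3 → V3), IsHardSphereEulerSolution σ T ρ u θ →
            (∀ t ∈ Ico 0 T, ∀ x, ρ t x * σ ^ 3 ≤ η₁ / 2) →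
            ∀ Φ : FlowFamily σ,
              TendstoHydroFieldsAt (fun N => localGibbsLaw σ a₀ u₀ θ₀ N (Φ N)) Φ ρ u θ 0 →
              ∀ ℓ : ℕ → ℝ, (∀ N, 0 < ℓ N ∧ ℓ N ≤ 1) → Tendsto ℓ atTop (𝓝 0) →
                Tendsto (fun N : ℕ => ℓ N ^ 3 * ((N : ℝ) + 1)) atTop atTop →
                ∀ τ ∈ Ico 0 T, ∀ a b : ℝ, a < b → ∀ φ : ℝ → T3 → ℝ,
                  Literature.Analysis.FunctionSpaces.Torus.IsSmoothSpaceTimeOn (Ico 0 T) φ →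
                  (∀ t ∈ Icc 0 τ, ∀ x, 0 ≤ φ t x) →
                  C σ η₁ a₀ θ₀ u₀ T ρ θ u Φ ℓ τ a b φ

/-- The frame holds for the trivial conclusion. -/
theorem InFrame.of_true : InFrame fun _ _ _ _ _ _ _ _ _ _ _ _ _ _ _ => True :=
  fun _ => ⟨1, one_pos, fun _ _ _ _ _ _ _ _ _ _ _ => ⟨1, one_pos, fun _ _ _ _ _ _ _ _ _ _ _ _ _ _ _ _ _ _ _ _ _ _ _ => trivial⟩⟩

/-- **Frame bookkeeping, once (arity 3).** If, at every instance of the frame with `η₁ < ηs` and `σ < σs` (two extra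
thresholds the caller may impose), the conclusions `C₁, C₂, C₃` imply `C₄`, then `InFrame C₁ → InFrame C₂ → InFrame C₃ →
InFrame C₄` (common band threshold `min ηs (min η¹ (min η² η³))`, common density threshold `min σs (min σ¹ (min σ² σ³))`). -/
theorem InFrame.mono₃ {C₁ C₂ C₃ C₄ : Conclusion} {ηs σs : ℝ} (hηs : 0 < ηs) (hσs : 0 < σs)
    (h : ∀ (σ η₁ : ℝ) (a₀ θ₀ : T3 → ℝ) (u₀ : T3 → V3) (T : ℝ) (ρ θ : ℝ → T3 → ℝ) (u : ℝ → T3 → V3)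
      (Φ : FlowFamily σ) (ℓ : ℕ → ℝ) (τ a b : ℝ) (φ : ℝ → T3 → ℝ),
      0 < η₁ → η₁ < ηs → Continuous a₀ → Continuous θ₀ → Continuous u₀ → (∀ x, 0 < a₀ x) → (∀ x, 0 < θ₀ x) →
      0 < σ → σ < σs → IsHardSphereEulerSolution σ T ρ u θ → (∀ t ∈ Ico 0 T, ∀ x, ρ t x * σ ^ 3 ≤ η₁ / 2) →
      TendstoHydroFieldsAt (fun N => localGibbsLaw σ a₀ u₀ θ₀ N (Φ N)) Φ ρ u θ 0 →
      (∀ N, 0 < ℓ N ∧ ℓ N ≤ 1) → Tendsto ℓ atTop (𝓝 0) → Tendsto (fun N : ℕ => ℓ N ^ 3 * ((N : ℝ) + 1)) atTop atTop →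
      τ ∈ Ico 0 T → a < b → Literature.Analysis.FunctionSpaces.Torus.IsSmoothSpaceTimeOn (Ico 0 T) φ →
      (∀ t ∈ Icc 0 τ, ∀ x, 0 ≤ φ t x) →
      C₁ σ η₁ a₀ θ₀ u₀ T ρ θ u Φ ℓ τ a b φ → C₂ σ η₁ a₀ θ₀ u₀ T ρ θ u Φ ℓ τ a b φ →
      C₃ σ η₁ a₀ θ₀ u₀ T ρ θ u Φ ℓ τ a b φ → C₄ σ η₁ a₀ θ₀ u₀ T ρ θ u Φ ℓ τ a b φ)
    (h₁ : InFrame C₁) (h₂ : InFrame C₂) (h₃ : InFrame C₃) : InFrame C₄ := by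
  intro hEos
  obtain ⟨η1, hη1, H1⟩ := h₁ hEos
  obtain ⟨η2, hη2, H2⟩ := h₂ hEos
  obtain ⟨η3, hη3, H3⟩ := h₃ hEos
  refine ⟨min ηs (min η1 (min η2 η3)), lt_min hηs (lt_min hη1 (lt_min hη2 hη3)), ?_⟩
  intro η₁ hη₁ hη₁c a₀ θ₀ u₀ ha hθ hu ha0 hθ0
  have hs : η₁ < ηs := lt_of_lt_of_le hη₁c (min_le_left _ _)
  have e1 : η₁ < η1 := lt_of_lt_of_le hη₁c ((min_le_right _ _).trans (min_le_left _ _))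
  have e2 : η₁ < η2 := lt_of_lt_of_le hη₁c ((min_le_right _ _).trans ((min_le_right _ _).trans (min_le_left _ _)))
  have e3 : η₁ < η3 := lt_of_lt_of_le hη₁c ((min_le_right _ _).trans ((min_le_right _ _).trans (min_le_right _ _)))
  obtain ⟨σ1, hσ1, G1⟩ := H1 η₁ hη₁ e1 a₀ θ₀ u₀ ha hθ hu ha0 hθ0
  obtain ⟨σ2, hσ2, G2⟩ := H2 η₁ hη₁ e2 a₀ θ₀ u₀ ha hθ hu ha0 hθ0
  obtain ⟨σ3, hσ3, G3⟩ := H3 η₁ hη₁ e3 a₀ θ₀ u₀ ha hθ hu ha0 hθ0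
  refine ⟨min σs (min σ1 (min σ2 σ3)), lt_min hσs (lt_min hσ1 (lt_min hσ2 hσ3)), ?_⟩
  intro σ hσ hσlt T ρ θ u hsol hguard Φ hLLN ℓ hℓ hℓ0 hℓ3 τ hτ a b hab φ hφ hφ0
  have ss : σ < σs := lt_of_lt_of_le hσlt (min_le_left _ _)
  have s1 : σ < σ1 := lt_of_lt_of_le hσlt ((min_le_right _ _).trans (min_le_left _ _))
  have s2 : σ < σ2 := lt_of_lt_of_le hσlt ((min_le_right _ _).trans ((min_le_right _ _).trans (min_le_left _ _)))
  have s3 : σ < σ3 := lt_of_lt_of_le hσlt ((min_le_right _ _).trans ((min_le_right _ _).trans (min_le_right _ _)))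
  exact h σ η₁ a₀ θ₀ u₀ T ρ θ u Φ ℓ τ a b φ hη₁ hs ha hθ hu ha0 hθ0 hσ ss hsol hguard hLLN hℓ hℓ0 hℓ3 hτ hab hφ hφ0
    (G1 σ hσ s1 T ρ θ u hsol hguard Φ hLLN ℓ hℓ hℓ0 hℓ3 τ hτ a b hab φ hφ hφ0)
    (G2 σ hσ s2 T ρ θ u hsol hguard Φ hLLN ℓ hℓ hℓ0 hℓ3 τ hτ a b hab φ hφ hφ0)
    (G3 σ hσ s3 T ρ θ u hsol hguard Φ hLLN ℓ hℓ hℓ0 hℓ3 τ hτ a b hab φ hφ hφ0)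

/-- **Frame bookkeeping (arity 2).** -/
theorem InFrame.mono₂ {C₁ C₂ C₃ : Conclusion} {ηs σs : ℝ} (hηs : 0 < ηs) (hσs : 0 < σs)
    (h : ∀ (σ η₁ : ℝ) (a₀ θ₀ : T3 → ℝ) (u₀ : T3 → V3) (T : ℝ) (ρ θ : ℝ → T3 → ℝ) (u : ℝ → T3 → V3)
      (Φ : FlowFamily σ) (ℓ : ℕ → ℝ) (τ a b : ℝ) (φ : ℝ → T3 → ℝ),
      0 < η₁ → η₁ < ηs → Continuous a₀ → Continuous θ₀ → Continuous u₀ → (∀ x, 0 < a₀ x) → (∀ x, 0 < θ₀ x) →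
      0 < σ → σ < σs → IsHardSphereEulerSolution σ T ρ u θ → (∀ t ∈ Ico 0 T, ∀ x, ρ t x * σ ^ 3 ≤ η₁ / 2) →
      TendstoHydroFieldsAt (fun N => localGibbsLaw σ a₀ u₀ θ₀ N (Φ N)) Φ ρ u θ 0 →
      (∀ N, 0 < ℓ N ∧ ℓ N ≤ 1) → Tendsto ℓ atTop (𝓝 0) → Tendsto (fun N : ℕ => ℓ N ^ 3 * ((N : ℝ) + 1)) atTop atTop →
      τ ∈ Ico 0 T → a < b → Literature.Analysis.FunctionSpaces.Torus.IsSmoothSpaceTimeOn (Ico 0 T) φ →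
      (∀ t ∈ Icc 0 τ, ∀ x, 0 ≤ φ t x) →
      C₁ σ η₁ a₀ θ₀ u₀ T ρ θ u Φ ℓ τ a b φ → C₂ σ η₁ a₀ θ₀ u₀ T ρ θ u Φ ℓ τ a b φ →
      C₃ σ η₁ a₀ θ₀ u₀ T ρ θ u Φ ℓ τ a b φ)
    (h₁ : InFrame C₁) (h₂ : InFrame C₂) : InFrame C₃ :=
  InFrame.mono₃ (C₃ := fun _ _ _ _ _ _ _ _ _ _ _ _ _ _ _ => True) hηs hσs
    (fun σ η₁ a₀ θ₀ u₀ T ρ θ u Φ ℓ τ a b φ hη₁ hs ha hθ hu ha0 hθ0 hσ ss hsol hguard hLLN hℓ hℓ0 hℓ3 hτ hab hφ hφ0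
      c₁ c₂ _ => h σ η₁ a₀ θ₀ u₀ T ρ θ u Φ ℓ τ a b φ hη₁ hs ha hθ hu ha0 hθ0 hσ ss hsol hguard hLLN hℓ hℓ0 hℓ3 hτ hab
        hφ hφ0 c₁ c₂) h₁ h₂ InFrame.of_true

/-! ## The conclusions -/

/-- The crux's conclusion: `E_{P_N}[(A_N + B_N)⁺] → 0`. -/
def Ccrux : Conclusion := fun σ η₁ a₀ θ₀ u₀ T _ρ _θ _u Φ ℓ τ a b φ =>
  Tendsto (fun N : ℕ => ∫⁻ z, ENNReal.ofReal (dynPart σ η₁ T ℓ Φ τ a b φ N z + initPart σ η₁ ℓ Φ a b φ N z)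
    ∂(localGibbsLaw σ a₀ u₀ θ₀ N (Φ N))) atTop (𝓝 0)

/-- The DYNAMIC CORE conclusion: `E_{P_N}[(A_N + B)⁺] → 0`, `B = initLimit` the deterministic initial entropy. -/
def Cdyn : Conclusion := fun σ η₁ a₀ θ₀ u₀ T ρ θ _u Φ ℓ τ a b φ =>
  Tendsto (fun N : ℕ => ∫⁻ z, ENNReal.ofReal (dynPart σ η₁ T ℓ Φ τ a b φ N z + initLimit σ η₁ ρ θ a b φ)
    ∂(localGibbsLaw σ a₀ u₀ θ₀ N (Φ N))) atTop (𝓝 0)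

/-- The statics conclusion S0: `E_{P_N}|B_N − B| → 0`. -/
def Cstat : Conclusion := fun σ η₁ a₀ θ₀ u₀ _T ρ θ _u Φ ℓ _τ a b φ =>
  Tendsto (fun N : ℕ => ∫⁻ z, ENNReal.ofReal |initPart σ η₁ ℓ Φ a b φ N z - initLimit σ η₁ ρ θ a b φ|
    ∂(localGibbsLaw σ a₀ u₀ θ₀ N (Φ N))) atTop (𝓝 0)

/-- The integrability conclusion S1a: `A_N ∈ L¹(P_N)` for every `N`. -/
def Cint : Conclusion := fun σ η₁ a₀ θ₀ u₀ T _ρ _θ _u Φ ℓ τ a b φ =>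
  ∀ N : ℕ, Integrable (dynPart σ η₁ T ℓ Φ τ a b φ N) (localGibbsLaw σ a₀ u₀ θ₀ N (Φ N))

/-- The annealed deficit conclusion S1b: for every `ε > 0`, eventually `E_{P_N}[A_N] + B ≤ ε`. -/
def Cdef : Conclusion := fun σ η₁ a₀ θ₀ u₀ T ρ θ _u Φ ℓ τ a b φ =>
  ∀ ε : ℝ, 0 < ε → ∀ᶠ N : ℕ in atTop,
    (∫ z, dynPart σ η₁ T ℓ Φ τ a b φ N z ∂(localGibbsLaw σ a₀ u₀ θ₀ N (Φ N))) + initLimit σ η₁ ρ θ a b φ ≤ ε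

/-- The concentration conclusion S2: `E_{P_N}|A_N − E_{P_N} A_N| → 0`. -/
def Cconc : Conclusion := fun σ η₁ a₀ θ₀ u₀ T _ρ _θ _u Φ ℓ τ a b φ =>
  Tendsto (fun N : ℕ => ∫⁻ z, ENNReal.ofReal
      |dynPart σ η₁ T ℓ Φ τ a b φ N z - ∫ z', dynPart σ η₁ T ℓ Φ τ a b φ N z' ∂(localGibbsLaw σ a₀ u₀ θ₀ N (Φ N))|
    ∂(localGibbsLaw σ a₀ u₀ θ₀ N (Φ N))) atTop (𝓝 0)

/-! ## Landed inputs, read in the frame -/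

/-- The crux IS the frame applied to `Ccrux` (definitional: the crux's `let`-bound functional is `dynPart + initPart`). -/
theorem entropyAdmissibility_iff_inFrame : BoxDissipativeWeakStrong.EntropyAdmissibility ↔ InFrame Ccrux :=
  Iff.rfl

/-- S0 (LANDED, S0b ∘ S0a): the initial entropy LLN, read in the frame. -/
theorem inFrame_stat : InFrame Cstat :=
  EABirthS0b.stub_initialEntropyLLN_of_modulus EABirthS0a.stub_entropyModulus

/-- S1a (LANDED): integrability of the dynamic part, read in the frame. -/
theorem inFrame_int : InFrame Cint := by
  intro hEos
  obtain ⟨ηc, hηc, H⟩ := EABirthS1a.stub_dynPartIntegrable hEos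
  refine ⟨ηc, hηc, fun η₁ hη₁ hη₁c a₀ θ₀ u₀ ha hθ hu ha0 hθ0 => ?_⟩
  obtain ⟨σ₀, hσ₀, G⟩ := H η₁ hη₁ hη₁c a₀ θ₀ u₀ ha hθ hu ha0 hθ0
  exact ⟨σ₀, hσ₀, fun σ hσ hσlt T ρ θ u hsol hguard Φ hLLN ℓ hℓ hℓ0 hℓ3 τ hτ a b hab φ hφ hφ0 =>
    G σ hσ hσlt T ρ θ u hsol hguard Φ hLLN ℓ hℓ hℓ0 hℓ3 τ hτ a b hab φ hφ hφ0⟩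

/-- Measurability input: `z ↦ ofReal |B_N(z) − B|` is a.e.-measurable under the local Gibbs law (the initial part is a
bounded measurable function of the configuration, `EABirthS1bNec.integrable_initPart`). -/
theorem aemeasurable_ofReal_abs_initPart_sub {η₀ σ η₁ T a b : ℝ} (hcont : ContinuousOn hsExcessFreeEnergy (Ico 0 η₀))
    (hσ : 0 ≤ σ) (hη₁ : 0 ≤ η₁) (hη₁c : η₁ < η₀) {ℓ : ℕ → ℝ} {N : ℕ} (Φ : FlowFamily σ) (hℓ : 0 < ℓ N)
    (hT : 0 < T) (hab : a ≤ b) {φ : ℝ → T3 → ℝ} (hφ : Torus.IsSmoothSpaceTimeOn (Ico 0 T) φ)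
    (P : Measure (Config (N + 1) (Fin 3) T3)) [IsFiniteMeasure P] (c : ℝ) :
    AEMeasurable (fun z => ENNReal.ofReal |initPart σ η₁ ℓ Φ a b φ N z - c|) P :=
  (continuous_abs.measurable.comp_aemeasurable
    ((EABirthS1bNec.integrable_initPart hcont hσ hη₁ hη₁c Φ hℓ hT hab hφ P).aestronglyMeasurable.aemeasurable.sub
      aemeasurable_const)).ennreal_ofReal

/-! ## The four implications -/

/-- **crux ⇒ dynamic core**: `(A + B)⁺ ≤ (A + B_N)⁺ + |B_N − B|`, integrated, with S0. -/
theorem inFrame_dyn_of_crux (h : BoxDissipativeWeakStrong.EntropyAdmissibility) : InFrame Cdyn := by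
  obtain ⟨η₀, hη₀, F, hFan, hFeq, -⟩ := BoxDissipativeWeakStrong.HsEosLowDensity_holds
  have hcont : ContinuousOn hsExcessFreeEnergy (Ico 0 η₀) :=
    (hFan.continuousOn.mono fun η hη => ⟨(neg_lt_zero.2 hη₀).trans_le hη.1, hη.2⟩).congr hFeq
  refine InFrame.mono₂ (C₁ := Ccrux) (C₂ := Cstat) hη₀ one_half_pos ?_ h inFrame_stat
  intro σ η₁ a₀ θ₀ u₀ T ρ θ u Φ ℓ τ a b φ hη₁ hs ha hθ hu ha0 hθ0 hσ ss _ _ _ hℓ _ _ hτ hab hφ _ c₁ c₂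
  haveI hP : ∀ N, IsProbabilityMeasure (localGibbsLaw σ a₀ u₀ θ₀ N (Φ N)) := fun N =>
    isProbabilityMeasure_localGibbsLaw ha hθ hu ha0 hθ0 ss.le N (Φ N)
  have hT : 0 < T := lt_of_le_of_lt hτ.1 hτ.2
  refine tendsto_lintegral_ofReal_of_le_add (fun N => localGibbsLaw σ a₀ u₀ θ₀ N (Φ N))
    (fun N z => dynPart σ η₁ T ℓ Φ τ a b φ N z + initLimit σ η₁ ρ θ a b φ)
    (fun N z => dynPart σ η₁ T ℓ Φ τ a b φ N z + initPart σ η₁ ℓ Φ a b φ N z)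
    (fun N z => |initPart σ η₁ ℓ Φ a b φ N z - initLimit σ η₁ ρ θ a b φ|) (fun N z => ?_)
    (fun N => aemeasurable_ofReal_abs_initPart_sub hcont hσ.le hη₁.le hs Φ (hℓ N).1 hT hab.le hφ _ _) c₁ c₂
  have := neg_abs_le (initPart σ η₁ ℓ Φ a b φ N z - initLimit σ η₁ ρ θ a b φ)
  linarith

/-- **dynamic core ⇒ crux**: `(A + B_N)⁺ ≤ (A + B)⁺ + |B_N − B|`, integrated, with S0. -/
theorem crux_of_inFrame_dyn (h : InFrame Cdyn) : BoxDissipativeWeakStrong.EntropyAdmissibility := by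
  obtain ⟨η₀, hη₀, F, hFan, hFeq, -⟩ := BoxDissipativeWeakStrong.HsEosLowDensity_holds
  have hcont : ContinuousOn hsExcessFreeEnergy (Ico 0 η₀) :=
    (hFan.continuousOn.mono fun η hη => ⟨(neg_lt_zero.2 hη₀).trans_le hη.1, hη.2⟩).congr hFeq
  rw [entropyAdmissibility_iff_inFrame]
  refine InFrame.mono₂ (C₁ := Cdyn) (C₂ := Cstat) hη₀ one_half_pos ?_ h inFrame_stat
  intro σ η₁ a₀ θ₀ u₀ T ρ θ u Φ ℓ τ a b φ hη₁ hs ha hθ hu ha0 hθ0 hσ ss _ _ _ hℓ _ _ hτ hab hφ _ c₁ c₂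
  haveI hP : ∀ N, IsProbabilityMeasure (localGibbsLaw σ a₀ u₀ θ₀ N (Φ N)) := fun N =>
    isProbabilityMeasure_localGibbsLaw ha hθ hu ha0 hθ0 ss.le N (Φ N)
  have hT : 0 < T := lt_of_le_of_lt hτ.1 hτ.2
  refine tendsto_lintegral_ofReal_of_le_add (fun N => localGibbsLaw σ a₀ u₀ θ₀ N (Φ N))
    (fun N z => dynPart σ η₁ T ℓ Φ τ a b φ N z + initPart σ η₁ ℓ Φ a b φ N z)
    (fun N z => dynPart σ η₁ T ℓ Φ τ a b φ N z + initLimit σ η₁ ρ θ a b φ)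
    (fun N z => |initPart σ η₁ ℓ Φ a b φ N z - initLimit σ η₁ ρ θ a b φ|) (fun N z => ?_)
    (fun N => aemeasurable_ofReal_abs_initPart_sub hcont hσ.le hη₁.le hs Φ (hℓ N).1 hT hab.le hφ _ _) c₁ c₂
  have := le_abs_self (initPart σ η₁ ℓ Φ a b φ N z - initLimit σ η₁ ρ θ a b φ)
  linarith

/-- **dynamic core ⇒ S1b** (the annealed deficit bound is NECESSARY for the core): `E[A] + B = E[A + B] ≤ E[(A + B)⁺]`,
with S1a for the Bochner mean. -/
theorem inFrame_def_of_inFrame_dyn (h : InFrame Cdyn) : InFrame Cdef := by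
  refine InFrame.mono₂ (C₁ := Cdyn) (C₂ := Cint) one_pos one_half_pos ?_ h inFrame_int
  intro σ η₁ a₀ θ₀ u₀ T ρ θ u Φ ℓ τ a b φ _ _ ha hθ hu ha0 hθ0 _ ss _ _ _ _ _ _ _ _ _ _ c₁ c₂
  haveI hP : ∀ N, IsProbabilityMeasure (localGibbsLaw σ a₀ u₀ θ₀ N (Φ N)) := fun N =>
    isProbabilityMeasure_localGibbsLaw ha hθ hu ha0 hθ0 ss.le N (Φ N)
  have h0 : Tendsto (fun N : ℕ => ∫⁻ _z, ENNReal.ofReal |initLimit σ η₁ ρ θ a b φ - initLimit σ η₁ ρ θ a b φ|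
      ∂(localGibbsLaw σ a₀ u₀ θ₀ N (Φ N))) atTop (𝓝 0) := by
    simp only [sub_self, abs_zero, ENNReal.ofReal_zero, lintegral_zero, tendsto_const_nhds]
  have h2 : Tendsto (fun N : ℕ => ∫⁻ z, ENNReal.ofReal
      (dynPart σ η₁ T ℓ Φ τ a b φ N z + initLimit σ η₁ ρ θ a b φ) ∂(localGibbsLaw σ a₀ u₀ θ₀ N (Φ N))) atTop (𝓝 0) :=
    c₁
  exact EABirthS1bNec.eventually_integral_add_const_le (fun N => localGibbsLaw σ a₀ u₀ θ₀ N (Φ N))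
    (fun N z => dynPart σ η₁ T ℓ Φ τ a b φ N z) (fun N _ => initLimit σ η₁ ρ θ a b φ) (initLimit σ η₁ ρ θ a b φ)
    c₂ (fun N => integrable_const _) h0 h2

/-- **S1b ⇒ S2 ⇒ dynamic core** (the line's sufficient split, minus statics): `(A + B)⁺ ≤ |A − E A| + (E A + B)⁺`,
with S1a for integrability. -/
theorem inFrame_dyn_of_def_of_conc (hdef : InFrame Cdef) (hconc : InFrame Cconc) : InFrame Cdyn := by
  refine InFrame.mono₃ (C₁ := Cint) (C₂ := Cdef) (C₃ := Cconc) one_pos one_half_pos ?_ inFrame_int hdef hconc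
  intro σ η₁ a₀ θ₀ u₀ T ρ θ u Φ ℓ τ a b φ _ _ ha hθ hu ha0 hθ0 _ ss _ _ _ _ _ _ _ _ _ _ c₁ c₂ c₃
  have hP : ∀ N, IsProbabilityMeasure (localGibbsLaw σ a₀ u₀ θ₀ N (Φ N)) := fun N =>
    isProbabilityMeasure_localGibbsLaw ha hθ hu ha0 hθ0 ss.le N (Φ N)
  exact tendsto_lintegral_ofReal_add_const (fun N => localGibbsLaw σ a₀ u₀ θ₀ N (Φ N)) hP
    (fun N z => dynPart σ η₁ T ℓ Φ τ a b φ N z) (initLimit σ η₁ ρ θ a b φ)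
    (fun ε hε => (c₂ ε hε).mono fun N hN => ⟨c₁ N, hN⟩) c₃

/-! ## The stub -/

/-- **Signature of the registered stub `stub_dynamicCoreSandwich`** (line `registered` of the crux stmt-AtomisticToContinuum-9903;
definitionally the skeleton's `Sig.stub_dynamicCoreSandwich`, whose `Sig.stub_dynamicCore`, `Sig.stub_meanEntropyDeficit`,
`Sig.stub_entropyBalanceConcentration` are `InFrame Cdyn`, `InFrame Cdef`, `InFrame Cconc` unfolded): the crux is EQUIVALENT to
its dynamic core `E[(A_N + B)⁺] → 0`, which implies the open heart S1b and follows from S1b together with the fluctuation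
statement S2. -/
def Sig.stub_dynamicCoreSandwich : Prop :=
  (BoxDissipativeWeakStrong.EntropyAdmissibility ↔ InFrame Cdyn) ∧
    (InFrame Cdyn → InFrame Cdef) ∧ (InFrame Cdef → InFrame Cconc → InFrame Cdyn)

/-- **Registered stub `stub_dynamicCoreSandwich`** (crux stmt-AtomisticToContinuum-9903, line `registered`): tightness of the
line's cut — `crux ⇔ DynCore`, `DynCore ⇒ S1b`, `S1b ⇒ S2 ⇒ DynCore`, all over landed theorems (S0, S1a). -/
theorem stub_dynamicCoreSandwich : Sig.stub_dynamicCoreSandwich :=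
  ⟨⟨inFrame_dyn_of_crux, crux_of_inFrame_dyn⟩, inFrame_def_of_inFrame_dyn, inFrame_dyn_of_def_of_conc⟩

end Summit.AtomisticToContinuum.HydrodynamicLimit.Theorems.EABirthCore

end
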